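import Summits.QuantumFields.BalabanUV.Beta.GAN24.FaceWordsDeepCurrents

/-!
# `BalabanUV.Beta.GAN24.CrossedFromThreeWords` — binder row G-an2-4 ∕ (CONV-C), W-slot (α-0), typer's PART VI row **T6-VAL**, the (γ) hand's letters **K7-a ∕ K7-0, THE ADAPTER's
# PATTERN SUM (γ)**: **FROM leaf-02 Part 47's THREE-WORD DISPLAY TO THE CROSSED VALUE** — the VALUE twin of leaf-02 Part 49 `ForcingFacePairFormGlue.pairFormLS_of_threeWords`: same data
# (`X`, the coarse dressed vertex family `D` with Part 45∕46's push law `hpush` onto the fine table `S`, an abstract face read `F` displayed as `c₀·(direct + swapped − Ww)`, the `W` face word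
# `Ww` with zero `LS` charge), but instead of F5's antisymmetries the VALUES of the fine words on the four crossed patterns of two directions `a₀, b₀` are given: direct `(b₀a₀;a₀b₀) = V₁`,
# `(a₀b₀;b₀a₀) = V₂`, zero on `(a₀b₀;a₀b₀)`, `(b₀a₀;b₀a₀)`; swapped `(a₀b₀;a₀b₀) = V₁`, `(b₀a₀;b₀a₀) = V₂`, zero on `(b₀a₀;a₀b₀)`, `(a₀b₀;b₀a₀)` — THEN the crossed orbit sum
# `X(F)(a₀,b₀) = LS(F(κκ′) + F(κ′κ))(a₀b₀;a₀b₀) = 4·c₀·K²·(V₁ + V₂)` (the count `8 = 2 × 4` of this lineage's memo `g57/K7-ZERO-g57.md` §3 as a theorem: the `LS` form doubles, and on each of the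
# four crossed patterns exactly one of direct∕swapped is off-diagonal)
# (G-an2-4 CRUX TEAM (2), seat `b2b-balaban-gan24-formalise-leaf-06` = the (γ) hand, gen 57; journal [GAN24LEAF06-G57-INTENT-6])

NOT IN PRINT; OUR BOOKKEEPING ([folklore] leaf-02 Part 45 `FaceWordsDeepCurrents.faceWord_direct_eq ∕ faceWord_swap_eq` BY NAME + `linear_combination`; the text follows leaf-02 Part 49;
0 `def`, 0 cited fact, 0 `def … : Prop`, 0 sorry).  HONEST FRAMING (cell contract, verbatim): «discharging `BetaPertH` makes Bałaban's UV stability UNCONDITIONAL — a real constructive-QFT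
result; it is NOT the continuum limit and NOT the Clay problem.»  HONEST DEPENDENCY (verbatim): «continuum YM on T⁴ ⇐ BetaPertH ∧ nine spine estimates (0/9 proved); BetaPertH ⇐ (D1) ∧ (D4) ∧
CAP+tail; G-an2-4 gates asym, D1 and NE2/3/4.»  Asserts NO value of any table (all eight values are hypotheses; the (γ) hand's `FaceWordFullZeroPatterns` supplies them at level 0);
discharges NOTHING of `hX` ∕ `hXu` ∕ (C) ∕ `hB0` ∕ `hBF` ∕ (Q-L); NEVER «G-an2-4 closed» as (CONV-C); NOT D1, NOT `BetaPertH`, NOT continuum, NOT Clay.  2026-08-24; no existing file touched.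
-/

noncomputable section

open Finset
open scoped BigOperators
open Literature.MathematicalPhysics.QuantumFieldTheory
open Literature.MathematicalPhysics.QuantumFieldTheory.Balaban1983to89
open Literature.MathematicalPhysics.QuantumFieldTheory.Balaban1983to89.Beta
open ExpKernelCalculus (Site MKer Decays BiLoc shiftK comp)
open OneStepResolventKernel (Fib LocStencil)
open AffineAveraging (box toSite)
open Summit.QuantumFields.BalabanUV.Beta.GAN24.FaceWordsDeepCurrents (faceWord_direct_eq faceWord_swap_eq)

namespace Summit.QuantumFields.BalabanUV.Beta.GAN24.CrossedFromThreeWords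

variable {d : ℕ} {Lc P N : ℕ} [NeZero P] [NeZero N]
variable {X : MKer (d + 1) (Fib d)} {D S : Fin (d + 1) → Site (d + 1) → MKer (d + 1) (Fib d)} {CX CD Cs δ : ℝ}

/-- NOT IN PRINT; OUR BOOKKEEPING.  **FROM THE THREE-WORD DISPLAY AND THE EIGHT FINE-WORD VALUES TO THE CROSSED VALUE** (module docstring): `X(F)(a₀,b₀) = 4·c₀·K²·(V₁ + V₂)`. -/
theorem crossed_of_threeWords (hLc : 1 ≤ Lc) (hX : Decays X CX δ) (hXt : ∀ s : Site (d + 1), shiftK (-((N : ℤ) • s)) X = X) (hδ : 0 < δ)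
    (hD : ∀ κ u, BiLoc (D κ u) ((Lc : ℤ) • u) ((Lc : ℤ) • u) CD δ)
    (hDt : ∀ (κ : Fin (d + 1)) (u s : Site (d + 1)), D κ (u + (P : ℤ) • s) = shiftK (-((N : ℤ) • s)) (D κ u))
    (hS : LocStencil S Cs δ) (hSt : ∀ (κ : Fin (d + 1)) (t s : Site (d + 1)), S κ (t + (N : ℤ) • s) = shiftK (-((N : ℤ) • s)) (S κ t)) (K : ℝ)
    (hpush : ∀ (κ : Fin (d + 1)) (x z : Site (d + 1)) (a b : Fib d),
      ∑' u : Site (d + 1), (if u κ % (P : ℤ) = (P : ℤ) - 1 then (1 : ℝ) else 0) * D κ u x z a b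
        = K * ∑' t : Site (d + 1), (if t κ % (N : ℤ) = (N : ℤ) - 1 then (1 : ℝ) else 0) * S κ t x z a b)
    (c₀ : ℝ) {F Ww : Fin (d + 1) → Fin (d + 1) → Fin (d + 1) → Fin (d + 1) → ℝ}
    (hdisp : ∀ μ ν α β : Fin (d + 1), F μ ν α β = c₀ *
      ((∑ r' ∈ box (d + 1) P, ∑' u' : Site (d + 1), (if toSite r' μ % (P : ℤ) = (P : ℤ) - 1 then (1 : ℝ) else 0) * (if u' ν % (P : ℤ) = (P : ℤ) - 1 then (1 : ℝ) else 0) *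
          ∑' yw : Site (d + 1) × Site (d + 1), ((if yw.1 α % (N : ℤ) = (N : ℤ) - 1 then (1 : ℝ) else 0) * (if yw.2 β % (N : ℤ) = (N : ℤ) - 1 then (1 : ℝ) else 0)) *
            comp (comp (D μ (toSite r')) X) (D ν u') yw.1 yw.2 (Sum.inl α) (Sum.inl β)) +
       (∑ r' ∈ box (d + 1) P, ∑' u' : Site (d + 1), (if toSite r' μ % (P : ℤ) = (P : ℤ) - 1 then (1 : ℝ) else 0) * (if u' ν % (P : ℤ) = (P : ℤ) - 1 then (1 : ℝ) else 0) *
          ∑' yw : Site (d + 1) × Site (d + 1), ((if yw.1 α % (N : ℤ) = (N : ℤ) - 1 then (1 : ℝ) else 0) * (if yw.2 β % (N : ℤ) = (N : ℤ) - 1 then (1 : ℝ) else 0)) *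
            comp (comp (D ν u') X) (D μ (toSite r')) yw.1 yw.2 (Sum.inl α) (Sum.inl β)) -
       Ww μ ν α β))
    (hW0 : ∀ κ κ' κ₁ κ₂ : Fin (d + 1), Ww κ κ' κ₁ κ₂ + Ww κ' κ κ₁ κ₂ + (Ww κ κ' κ₂ κ₁ + Ww κ' κ κ₂ κ₁) = 0)
    {a₀ b₀ : Fin (d + 1)} {V₁ V₂ : ℝ}
    (hD1 : (∑ rr ∈ box (d + 1) N, ∑' t : Site (d + 1), (if toSite rr b₀ % (N : ℤ) = (N : ℤ) - 1 then (1 : ℝ) else 0) * (if t a₀ % (N : ℤ) = (N : ℤ) - 1 then (1 : ℝ) else 0) *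
        ∑' yw : Site (d + 1) × Site (d + 1), ((if yw.1 a₀ % (N : ℤ) = (N : ℤ) - 1 then (1 : ℝ) else 0) * (if yw.2 b₀ % (N : ℤ) = (N : ℤ) - 1 then (1 : ℝ) else 0)) *
          comp (comp (S b₀ (toSite rr)) X) (S a₀ t) yw.1 yw.2 (Sum.inl a₀) (Sum.inl b₀)) = V₁)
    (hD2 : (∑ rr ∈ box (d + 1) N, ∑' t : Site (d + 1), (if toSite rr a₀ % (N : ℤ) = (N : ℤ) - 1 then (1 : ℝ) else 0) * (if t b₀ % (N : ℤ) = (N : ℤ) - 1 then (1 : ℝ) else 0) *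
        ∑' yw : Site (d + 1) × Site (d + 1), ((if yw.1 b₀ % (N : ℤ) = (N : ℤ) - 1 then (1 : ℝ) else 0) * (if yw.2 a₀ % (N : ℤ) = (N : ℤ) - 1 then (1 : ℝ) else 0)) *
          comp (comp (S a₀ (toSite rr)) X) (S b₀ t) yw.1 yw.2 (Sum.inl b₀) (Sum.inl a₀)) = V₂)
    (hD3 : (∑ rr ∈ box (d + 1) N, ∑' t : Site (d + 1), (if toSite rr a₀ % (N : ℤ) = (N : ℤ) - 1 then (1 : ℝ) else 0) * (if t b₀ % (N : ℤ) = (N : ℤ) - 1 then (1 : ℝ) else 0) *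
        ∑' yw : Site (d + 1) × Site (d + 1), ((if yw.1 a₀ % (N : ℤ) = (N : ℤ) - 1 then (1 : ℝ) else 0) * (if yw.2 b₀ % (N : ℤ) = (N : ℤ) - 1 then (1 : ℝ) else 0)) *
          comp (comp (S a₀ (toSite rr)) X) (S b₀ t) yw.1 yw.2 (Sum.inl a₀) (Sum.inl b₀)) = 0)
    (hD4 : (∑ rr ∈ box (d + 1) N, ∑' t : Site (d + 1), (if toSite rr b₀ % (N : ℤ) = (N : ℤ) - 1 then (1 : ℝ) else 0) * (if t a₀ % (N : ℤ) = (N : ℤ) - 1 then (1 : ℝ) else 0) *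
        ∑' yw : Site (d + 1) × Site (d + 1), ((if yw.1 b₀ % (N : ℤ) = (N : ℤ) - 1 then (1 : ℝ) else 0) * (if yw.2 a₀ % (N : ℤ) = (N : ℤ) - 1 then (1 : ℝ) else 0)) *
          comp (comp (S b₀ (toSite rr)) X) (S a₀ t) yw.1 yw.2 (Sum.inl b₀) (Sum.inl a₀)) = 0)
    (hS1 : (∑ rr ∈ box (d + 1) N, ∑' t : Site (d + 1), (if toSite rr a₀ % (N : ℤ) = (N : ℤ) - 1 then (1 : ℝ) else 0) * (if t b₀ % (N : ℤ) = (N : ℤ) - 1 then (1 : ℝ) else 0) *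
        ∑' yw : Site (d + 1) × Site (d + 1), ((if yw.1 a₀ % (N : ℤ) = (N : ℤ) - 1 then (1 : ℝ) else 0) * (if yw.2 b₀ % (N : ℤ) = (N : ℤ) - 1 then (1 : ℝ) else 0)) *
          comp (comp (S b₀ t) X) (S a₀ (toSite rr)) yw.1 yw.2 (Sum.inl a₀) (Sum.inl b₀)) = V₁)
    (hS2 : (∑ rr ∈ box (d + 1) N, ∑' t : Site (d + 1), (if toSite rr b₀ % (N : ℤ) = (N : ℤ) - 1 then (1 : ℝ) else 0) * (if t a₀ % (N : ℤ) = (N : ℤ) - 1 then (1 : ℝ) else 0) *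
        ∑' yw : Site (d + 1) × Site (d + 1), ((if yw.1 b₀ % (N : ℤ) = (N : ℤ) - 1 then (1 : ℝ) else 0) * (if yw.2 a₀ % (N : ℤ) = (N : ℤ) - 1 then (1 : ℝ) else 0)) *
          comp (comp (S a₀ t) X) (S b₀ (toSite rr)) yw.1 yw.2 (Sum.inl b₀) (Sum.inl a₀)) = V₂)
    (hS3 : (∑ rr ∈ box (d + 1) N, ∑' t : Site (d + 1), (if toSite rr b₀ % (N : ℤ) = (N : ℤ) - 1 then (1 : ℝ) else 0) * (if t a₀ % (N : ℤ) = (N : ℤ) - 1 then (1 : ℝ) else 0) *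
        ∑' yw : Site (d + 1) × Site (d + 1), ((if yw.1 a₀ % (N : ℤ) = (N : ℤ) - 1 then (1 : ℝ) else 0) * (if yw.2 b₀ % (N : ℤ) = (N : ℤ) - 1 then (1 : ℝ) else 0)) *
          comp (comp (S a₀ t) X) (S b₀ (toSite rr)) yw.1 yw.2 (Sum.inl a₀) (Sum.inl b₀)) = 0)
    (hS4 : (∑ rr ∈ box (d + 1) N, ∑' t : Site (d + 1), (if toSite rr a₀ % (N : ℤ) = (N : ℤ) - 1 then (1 : ℝ) else 0) * (if t b₀ % (N : ℤ) = (N : ℤ) - 1 then (1 : ℝ) else 0) *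
        ∑' yw : Site (d + 1) × Site (d + 1), ((if yw.1 b₀ % (N : ℤ) = (N : ℤ) - 1 then (1 : ℝ) else 0) * (if yw.2 a₀ % (N : ℤ) = (N : ℤ) - 1 then (1 : ℝ) else 0)) *
          comp (comp (S b₀ t) X) (S a₀ (toSite rr)) yw.1 yw.2 (Sum.inl b₀) (Sum.inl a₀)) = 0) :
    (F a₀ b₀ a₀ b₀ + F b₀ a₀ a₀ b₀) + (F b₀ a₀ a₀ b₀ + F a₀ b₀ a₀ b₀) + ((F a₀ b₀ b₀ a₀ + F b₀ a₀ b₀ a₀) + (F b₀ a₀ b₀ a₀ + F a₀ b₀ b₀ a₀))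
      = 4 * (c₀ * (K * K)) * (V₁ + V₂) := by
  classical
  -- the indicator weights meet Part 45's hypotheses (as in leaf-02 Part 49)
  have hw : ∀ (κ : Fin (d + 1)) (u : Site (d + 1)), |(fun (κ : Fin (d + 1)) (u : Site (d + 1)) => if u κ % (P : ℤ) = (P : ℤ) - 1 then (1 : ℝ) else 0) κ u| ≤ 1 := by
    intro κ u; simp only; split_ifs <;> simp
  have hw' : ∀ (κ : Fin (d + 1)) (t : Site (d + 1)), |(fun (κ : Fin (d + 1)) (t : Site (d + 1)) => if t κ % (N : ℤ) = (N : ℤ) - 1 then (1 : ℝ) else 0) κ t| ≤ 1 := by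
    intro κ t; simp only; split_ifs <;> simp
  have hwP : ∀ (κ : Fin (d + 1)) (u s : Site (d + 1)), (fun (κ : Fin (d + 1)) (u : Site (d + 1)) => if u κ % (P : ℤ) = (P : ℤ) - 1 then (1 : ℝ) else 0) κ (u + (P : ℤ) • s)
      = (fun (κ : Fin (d + 1)) (u : Site (d + 1)) => if u κ % (P : ℤ) = (P : ℤ) - 1 then (1 : ℝ) else 0) κ u := by
    intro κ u s; simp only [PairingCellTransfer.face_coord_add_zsmul]
  have hw'N : ∀ (κ : Fin (d + 1)) (t s : Site (d + 1)), (fun (κ : Fin (d + 1)) (t : Site (d + 1)) => if t κ % (N : ℤ) = (N : ℤ) - 1 then (1 : ℝ) else 0) κ (t + (N : ℤ) • s)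
      = (fun (κ : Fin (d + 1)) (t : Site (d + 1)) => if t κ % (N : ℤ) = (N : ℤ) - 1 then (1 : ℝ) else 0) κ t := by
    intro κ t s; simp only [PairingCellTransfer.face_coord_add_zsmul]
  have hm : ∀ (α β : Fin (d + 1)) (yw : Site (d + 1) × Site (d + 1)),
      |(fun yw : Site (d + 1) × Site (d + 1) => (if yw.1 α % (N : ℤ) = (N : ℤ) - 1 then (1 : ℝ) else 0) * (if yw.2 β % (N : ℤ) = (N : ℤ) - 1 then (1 : ℝ) else 0)) yw| ≤ 1 := by
    intro α β yw; simp only; split_ifs <;> simp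
  have hmN : ∀ (α β : Fin (d + 1)) (y w₀ s : Site (d + 1)),
      (fun yw : Site (d + 1) × Site (d + 1) => (if yw.1 α % (N : ℤ) = (N : ℤ) - 1 then (1 : ℝ) else 0) * (if yw.2 β % (N : ℤ) = (N : ℤ) - 1 then (1 : ℝ) else 0))
          (y + (N : ℤ) • s, w₀ + (N : ℤ) • s)
        = (fun yw : Site (d + 1) × Site (d + 1) => (if yw.1 α % (N : ℤ) = (N : ℤ) - 1 then (1 : ℝ) else 0) * (if yw.2 β % (N : ℤ) = (N : ℤ) - 1 then (1 : ℝ) else 0)) (y, w₀) := by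
    intro α β y w₀ s; simp only [PairingCellTransfer.face_coord_add_zsmul]
  -- Part 45: both coarse words are `K²·` the fine words
  have hd := fun μ ν α β => faceWord_direct_eq (P := P) (N := N) hLc hX hXt hδ hD hDt hS hSt
    (fun κ u => if u κ % (P : ℤ) = (P : ℤ) - 1 then (1 : ℝ) else 0) (fun κ t => if t κ % (N : ℤ) = (N : ℤ) - 1 then (1 : ℝ) else 0)
    hw hw' hwP hw'N K hpush (fun yw : Site (d + 1) × Site (d + 1) => (if yw.1 α % (N : ℤ) = (N : ℤ) - 1 then (1 : ℝ) else 0) * (if yw.2 β % (N : ℤ) = (N : ℤ) - 1 then (1 : ℝ) else 0))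
    (hm α β) (hmN α β) μ ν (Sum.inl α) (Sum.inl β)
  have hs := fun μ ν α β => faceWord_swap_eq (P := P) (N := N) hLc hX hXt hδ hD hDt hS hSt
    (fun κ u => if u κ % (P : ℤ) = (P : ℤ) - 1 then (1 : ℝ) else 0) (fun κ t => if t κ % (N : ℤ) = (N : ℤ) - 1 then (1 : ℝ) else 0)
    hw hw' hwP hw'N K hpush (fun yw : Site (d + 1) × Site (d + 1) => (if yw.1 α % (N : ℤ) = (N : ℤ) - 1 then (1 : ℝ) else 0) * (if yw.2 β % (N : ℤ) = (N : ℤ) - 1 then (1 : ℝ) else 0))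
    (hm α β) (hmN α β) μ ν (Sum.inl α) (Sum.inl β)
  -- the four crossed patterns
  have e1 : F a₀ b₀ a₀ b₀ = c₀ * ((K * K) * 0 + (K * K) * V₁ - Ww a₀ b₀ a₀ b₀) := by
    have h1 := hd a₀ b₀ a₀ b₀
    have h2 := hs a₀ b₀ a₀ b₀
    beta_reduce at h1 h2
    rw [hdisp, h1, h2, hD3, hS1]
  have e2 : F b₀ a₀ a₀ b₀ = c₀ * ((K * K) * V₁ + (K * K) * 0 - Ww b₀ a₀ a₀ b₀) := by
    have h1 := hd b₀ a₀ a₀ b₀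
    have h2 := hs b₀ a₀ a₀ b₀
    beta_reduce at h1 h2
    rw [hdisp, h1, h2, hD1, hS3]
  have e3 : F a₀ b₀ b₀ a₀ = c₀ * ((K * K) * V₂ + (K * K) * 0 - Ww a₀ b₀ b₀ a₀) := by
    have h1 := hd a₀ b₀ b₀ a₀
    have h2 := hs a₀ b₀ b₀ a₀
    beta_reduce at h1 h2
    rw [hdisp, h1, h2, hD2, hS4]
  have e4 : F b₀ a₀ b₀ a₀ = c₀ * ((K * K) * 0 + (K * K) * V₂ - Ww b₀ a₀ b₀ a₀) := by
    have h1 := hd b₀ a₀ b₀ a₀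
    have h2 := hs b₀ a₀ b₀ a₀
    beta_reduce at h1 h2
    rw [hdisp, h1, h2, hD4, hS2]
  rw [e1, e2, e3, e4]
  linear_combination (-(2 * c₀)) * hW0 a₀ b₀ a₀ b₀

end Summit.QuantumFields.BalabanUV.Beta.GAN24.CrossedFromThreeWords

end
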